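import Summits.BirchSwinnertonDyer.BirchSwinnertonDyer.Theorems.PrintCFramBottomClassIndexLawFiveLeFlipRungSlashCoeff
import Literature.NumberTheory.EllipticCurves.HalfIntegralWeightFormsProofs
import HarnessLib

set_option autoImplicit false

/-!
# Crux `PrintCFram.BottomClassIndexLawFiveLe` (stmt-BirchSwinnertonDyer-20372), line `eisenstein-resource-bdp-line` (registry v29):
# T6 «THE 2-ADIC FLIPPED-CUSP RUNG», piece P3 — THE EVEN TRANSLATES AT THE FLIPPED CUSP HAVE PERIOD `1/4` (THE JUNK)
# (cell `bsd-print-cfram`, width seat `bsd-line-cfram-p1-w5` g8; THEOREMS ONLY, `--supports` 20372; BSD is not proved by any of this)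

HONEST FRAMING. Pure bookkeeping about points of `ℍ`, Shimura's automorphy factor `j(γ, z)` of the tree
(`thetaFactor`, `autFactor`, `halfIntModularForms`) and `q`-series; nothing here is a statement about elliptic curves, Bernoulli
numbers or BSD; no registered stub is closed. This is piece P3 of w7 g8's kernel architecture of the 2-adic rung (crux notes
`Lines/eisenstein-resource-bdp-line-w7g8-T6.md` v3 §5c): at the flipped cusp `W = γ₀·diag(64,1)`, `γ₀ = [a b; M 64] ∈ SL₂(ℤ)`
(`64a − bM = 1`, `M` the odd level), the class cut `P_c g = (1/8)Σ_{j mod 8} e(−cj/8) g(· + j/8)` of a half-integral weight form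
`g ∈ M_{κ/2}(N, ψ)` splits into the odd translates (P1, w7 g8: the flip identity with the Gauss-sum weights of T6a) and the EVEN
translates `g(j/8 + γ₀•(64w))`, `j = 2j₁`. Here: the even translates, normalised by `√(M·(64w) + 64)^κ`, are `(1/4)`-PERIODIC in `w`,
so their `q`-series carries only frequencies `≡ 0 (mod 4)` and cannot pollute the coefficients the flip reads (`4 ∤ n`).

* §1 THE CONJUGATION: `N′ := (τ(j₁/4)γ₀)·τ(16)·(τ(j₁/4)γ₀)⁻¹ = [1 − 4Mu, u²; −16M², 1 + 4Mu]`, `u = 4a + Mj₁` — INTEGRAL because the translate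
  is `j/8` with `j` even; `N′ • (j₁/4 + γ₀•w′) = j₁/4 + γ₀•(w′ + 16)` and `denom N′ (j₁/4 + γ₀•w′) = (M(w′+16) + 64)/(Mw′ + 64)`.
* §2 THE MULTIPLIER OF `N′` IS TRIVIAL: `ε_{1+4Mu} = 1`, Shimura's `(−16M² / 1+4Mu) = 1` for BOTH signs of `1 + 4Mu` (the tree's sign convention
  for `c < 0 ∧ d < 0` exactly compensates `χ₋₄(|d|) = −1`), `N′ ∈ Γ₀(N)` for `N ∣ 16M²`, `ψ(1 + 4Mu) = 1` for `N ∣ 4Mu`, so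
  `autFactor κ N ψ N′ (j₁/4 + γ₀•w′) = √((M(w′+16)+64)/(Mw′+64))^κ`; and the branch relation `√(Y/X) = √Y/√X` for `X, Y` in the upper
  half-plane (the tree's `csqrt_div_mul_csqrt`).
* §3 **`junkTranslate_periodic_of_ratio`** (core, any admissible base pair `X, Y` in the upper half-plane with
  `Y/X = (M(w′+16)+64)/(Mw′+64)`): for `g ∈ halfIntModularForms κ N ψ`, `4 ∣ N`, `N ∣ 16M²`, `N ∣ 4Mu`:
  `g(j₁/4 + γ₀•(w′+16))·(√Y^κ)⁻¹ = g(j₁/4 + γ₀•w′)·(√X^κ)⁻¹`; instances **`junkTranslate_periodic`** (`X = Mw′+64`, period `16` in `w′`)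
  and **`junkTranslate_periodic_quarter`** (the variable `w`, `w′ = 64•w`, period `1/4`, P1's base `X = 8(Mw+1)` — w7 g8's
  `apply_translate_flippedCusp`).
* §4 THE GENERIC COEFFICIENT LEMMA (T3 (D) / T8 (D′) abstracted): if `T = MAIN + JUNK` pointwise, `T` and `MAIN` have `𝕢_H`-expansions with
  coefficients `g`, `m`, and `JUNK(P + w) = JUNK(w)`, then `g K = m K` at every `K` with `e(PK/H) ≠ 1` — no holomorphy or boundedness of
  the junk is used; with `cexp_two_pi_I_mul_div_ne_one` (`e(K/n) ≠ 1` for `n ∤ K`).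
beyond-print theorem: NO.

References: [Shimura1973HalfIntegral] §1 (the factor `j(γ,z)`, Prop. 1.3–1.5); [Knopp1970] Ch. 4 Thm. 3; [DiamondShurman2005] §1.1–1.2;
crux notes w7g8-T6 §1b, §5c (P3).
-/

-- summit-side namespace `Summit.BirchSwinnertonDyer.BirchSwinnertonDyer.…` (single-conjunct summit, D-0017 layout)
set_option linter.dupNamespace false

noncomputable section

open scoped MatrixGroups ModularForm Real Classical Topology NumberTheorySymbols
open UpperHalfPlane hiding I
open Complex Matrix.GeneralLinearGroup CongruenceSubgroup Function Filter
open Literature.NumberTheory.EllipticCurves.ModularForms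

namespace Summit.BirchSwinnertonDyer.BirchSwinnertonDyer.Theorems.PrintCFram.FlipRung

/-! ## §1 The conjugation matrix `N′` and the point identity -/

/-- **Determinant of `N′ = [1 − 4Mu, u²; −16M², 1 + 4Mu]`** (`u = 4a + Mj₁`). [folklore] -/
theorem det_junkConj_eq_one (M a j₁ : ℤ) :
    Matrix.det !![1 - 4 * M * (4 * a + M * j₁), (4 * a + M * j₁) ^ 2; -(16 * M ^ 2), 1 + 4 * M * (4 * a + M * j₁)] = 1 := by
  rw [Matrix.det_fin_two_of]
  ring

/-- **The Möbius identity behind the even translates** (as complex numbers). With `64a − bM = 1`, `Mw + 64 ≠ 0` and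
`M(w+16) + 64 ≠ 0`: `N′` applied to `j₁/4 + (aw+b)/(Mw+64)` is `j₁/4 + (a(w+16)+b)/(M(w+16)+64)`, and its denominator there is
`(M(w+16)+64)/(Mw+64)` (`N′ = τ(j₁/4)·γ₀τ(16)γ₀⁻¹·τ(−j₁/4)`). [cite: DiamondShurman2005, §1.2] -/
theorem junkConj_moebius_eq {a b M j₁ w : ℂ} (hdet : a * 64 - b * M = 1) (hw : M * w + 64 ≠ 0)
    (hw16 : M * (w + 16) + 64 ≠ 0) :
    ((1 - 4 * M * (4 * a + M * j₁)) * (j₁ / 4 + (a * w + b) / (M * w + 64)) + (4 * a + M * j₁) ^ 2) /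
        (-(16 * M ^ 2) * (j₁ / 4 + (a * w + b) / (M * w + 64)) + (1 + 4 * M * (4 * a + M * j₁))) =
      j₁ / 4 + (a * (w + 16) + b) / (M * (w + 16) + 64) ∧
    -(16 * M ^ 2) * (j₁ / 4 + (a * w + b) / (M * w + 64)) + (1 + 4 * M * (4 * a + M * j₁)) =
      (M * (w + 16) + 64) / (M * w + 64) := by
  have hden : -(16 * M ^ 2) * (j₁ / 4 + (a * w + b) / (M * w + 64)) + (1 + 4 * M * (4 * a + M * j₁)) =
      (M * (w + 16) + 64) / (M * w + 64) := by
    rw [eq_div_iff hw]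
    field_simp
    linear_combination (64 * M) * hdet
  have hnum : (1 - 4 * M * (4 * a + M * j₁)) * (j₁ / 4 + (a * w + b) / (M * w + 64)) + (4 * a + M * j₁) ^ 2 =
      (j₁ / 4 * (M * (w + 16) + 64) + (a * (w + 16) + b)) / (M * w + 64) := by
    rw [eq_div_iff hw]
    field_simp
    linear_combination (16 * a * 4 + 16 * M * j₁) * hdet
  refine ⟨?_, hden⟩
  rw [hnum, hden, div_div_div_cancel_right₀ hw, add_div, mul_div_assoc, div_self hw16, mul_one]

/-- **The even-translate conjugation read on `ℍ`.** Let `γ₀ = [a b; M 64] ∈ SL₂(ℤ)`, `j₁ ∈ ℤ`, `u = 4a + Mj₁` and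
`N′ = [1 − 4Mu, u²; −16M², 1 + 4Mu] ∈ SL₂(ℤ)`. Then for every `w′ ∈ ℍ`:
`N′ • (j₁/4 + γ₀•w′) = j₁/4 + γ₀•(w′ + 16)` and `denom N′ (j₁/4 + γ₀•w′) = (M(w′+16) + 64)/(Mw′ + 64)`.
[cite: DiamondShurman2005, §1.2] -/
theorem junkConj_smul_eq (γ₀ N' : SL(2, ℤ)) {M : ℤ} (hM : γ₀ 1 0 = M) (h64 : γ₀ 1 1 = 64) (j₁ : ℤ)
    (n00 : N' 0 0 = 1 - 4 * M * (4 * γ₀ 0 0 + M * j₁)) (n01 : N' 0 1 = (4 * γ₀ 0 0 + M * j₁) ^ 2)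
    (n10 : N' 1 0 = -(16 * M ^ 2)) (n11 : N' 1 1 = 1 + 4 * M * (4 * γ₀ 0 0 + M * j₁)) (w : ℍ) :
    N' • (((j₁ : ℝ) / 4) +ᵥ (γ₀ • w)) = ((j₁ : ℝ) / 4) +ᵥ (γ₀ • ((16 : ℝ) +ᵥ w)) ∧
    denom N' (((j₁ : ℝ) / 4) +ᵥ (γ₀ • w)) = ((M : ℂ) * (((16 : ℝ) +ᵥ w : ℍ) : ℂ) + 64) / ((M : ℂ) * w + 64) := by
  have hdetZ : γ₀ 0 0 * 64 - γ₀ 0 1 * M = 1 := by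
    have := Matrix.det_fin_two (γ₀ : Matrix (Fin 2) (Fin 2) ℤ)
    rw [Matrix.SpecialLinearGroup.det_coe, hM, h64] at this
    linear_combination -this
  have hdetC : (γ₀ 0 0 : ℂ) * 64 - (γ₀ 0 1 : ℂ) * M = 1 := by exact_mod_cast hdetZ
  have hden0 : denom γ₀ w = (M : ℂ) * w + 64 := by
    rw [ModularGroup.denom_apply, hM, h64]; push_cast; ring
  have hden16 : denom γ₀ ((16 : ℝ) +ᵥ w) = (M : ℂ) * ((w : ℂ) + 16) + 64 := by
    rw [ModularGroup.denom_apply, hM, h64, coe_vadd]; push_cast; ring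
  have hw : (M : ℂ) * w + 64 ≠ 0 := by rw [← hden0]; exact denom_ne_zero γ₀ w
  have hw16 : (M : ℂ) * ((w : ℂ) + 16) + 64 ≠ 0 := by rw [← hden16]; exact denom_ne_zero γ₀ _
  obtain ⟨hmob, hden⟩ := junkConj_moebius_eq (j₁ := (j₁ : ℂ)) hdetC hw hw16
  -- the two points as complex numbers
  have hγw : ((γ₀ • w : ℍ) : ℂ) = ((γ₀ 0 0 : ℂ) * w + (γ₀ 0 1 : ℂ)) / ((M : ℂ) * w + 64) := by
    rw [coe_specialLinearGroup_apply, hM, h64]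
    simp only [eq_intCast, Int.cast_ofNat]
    push_cast
    ring
  have hγw16 : ((γ₀ • ((16 : ℝ) +ᵥ w) : ℍ) : ℂ) = ((γ₀ 0 0 : ℂ) * ((w : ℂ) + 16) + (γ₀ 0 1 : ℂ)) / ((M : ℂ) * ((w : ℂ) + 16) + 64) := by
    rw [coe_specialLinearGroup_apply, hM, h64, coe_vadd]
    simp only [eq_intCast, Int.cast_ofNat]
    push_cast
    ring_nf
  have hpt : ((((j₁ : ℝ) / 4) +ᵥ (γ₀ • w) : ℍ) : ℂ) = (j₁ : ℂ) / 4 + ((γ₀ 0 0 : ℂ) * w + (γ₀ 0 1 : ℂ)) / ((M : ℂ) * w + 64) := by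
    rw [coe_vadd, hγw]; push_cast; ring
  constructor
  · apply UpperHalfPlane.ext
    rw [coe_specialLinearGroup_apply, hpt, coe_vadd, hγw16]
    simp only [n00, n01, n10, n11, eq_intCast, Int.cast_add, Int.cast_mul, Int.cast_pow, Int.cast_sub, Int.cast_one,
      Int.cast_neg, Int.cast_ofNat]
    push_cast
    rw [hmob]
  · rw [ModularGroup.denom_apply, hpt, n10, n11, coe_vadd]
    push_cast
    rw [hden]
    ring_nf

/-! ## §2 The multiplier of `N′` is trivial; the branch relation -/

/-- `ε_{1 + 4Mu} = 1`. [folklore] -/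
theorem thetaEps_one_add_four_mul (M u : ℤ) : thetaEps (1 + 4 * M * u) = 1 := by
  unfold thetaEps
  have h : (1 + 4 * M * u) % 4 = 1 := by
    rw [mul_assoc, Int.add_mul_emod_self_left]; norm_num
  rw [if_neg (by rw [h]; norm_num)]

/-- **Shimura's symbol `(−16M² / 1 + 4Mu) = 1` for `M ≠ 0`, for BOTH signs of `d = 1 + 4Mu`.** For `d > 0`:
`J(−16M² | d) = χ₋₄(d)·J((4M)² | d) = 1` (`d ≡ 1 (mod 4)`, `gcd(4M, d) = 1`); for `d < 0`: `J(−16M² | |d|) = χ₋₄(|d|) = −1`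
(`|d| ≡ 3 (mod 4)`) and the tree's convention multiplies by `−1` when `c < 0 ∧ d < 0`. [cite: Shimura1973HalfIntegral, §1] -/
theorem shimuraSymbol_neg_sq_one_add_four_mul {M : ℤ} (hM : M ≠ 0) (u : ℤ) :
    shimuraSymbol (-(16 * M ^ 2)) (1 + 4 * M * u) = 1 := by
  have hc : -(16 * M ^ 2) < 0 := by
    have : 0 < M ^ 2 := by positivity
    linarith
  have hcop : IsCoprime (4 * M) (1 + 4 * M * u) := ⟨-u, 1, by ring⟩
  generalize ht : 1 + 4 * M * u = d at hcop ⊢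
  have hd4 : d % 4 = 1 := by
    rw [← ht, mul_assoc, Int.add_mul_emod_self_left]; norm_num
  have hodd : Odd d.natAbs := by
    rw [Int.natAbs_odd, Int.odd_iff]; omega
  -- `J(−16M² | |d|) = χ₄(|d|)`
  have hgcd : (4 * M).gcd (d.natAbs : ℤ) = 1 := by
    have h1 : Int.gcd (4 * M) d = 1 := Int.isCoprime_iff_gcd_eq_one.mp hcop
    simpa [Int.gcd, Int.natAbs_abs] using h1
  have hJ : J(-(16 * M ^ 2) | d.natAbs) = ZMod.χ₄ (d.natAbs : ZMod 4) := by
    rw [show -(16 * M ^ 2) = (-1) * (4 * M) ^ 2 by ring, jacobiSym.mul_left, jacobiSym.sq_one' hgcd, mul_one,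
      jacobiSym.at_neg_one hodd]
  unfold shimuraSymbol
  rw [hJ]
  rcases lt_or_gt_of_ne (show d ≠ 0 by omega) with hneg | hpos
  · -- `d < 0`: `|d| ≡ 3 (mod 4)`
    have hnat : (d.natAbs : ℤ) = -d := Int.ofNat_natAbs_of_nonpos hneg.le
    have h3 : d.natAbs % 4 = 3 := by omega
    rw [if_pos ⟨hc, hneg⟩, ZMod.χ₄_nat_three_mod_four h3]
    norm_num
  · -- `d > 0`: `|d| ≡ 1 (mod 4)`
    have hnat : (d.natAbs : ℤ) = d := Int.natAbs_of_nonneg hpos.le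
    have h1 : d.natAbs % 4 = 1 := by omega
    rw [if_neg (fun h ↦ absurd h.2 (not_lt.mpr hpos.le)), ZMod.χ₄_nat_one_mod_four h1]
    norm_num

/-- `N′ ∈ Γ₀(N)` when `N ∣ 16M²`. [folklore] -/
theorem junkConj_mem_Gamma0 {N : ℕ} (N' : SL(2, ℤ)) {M : ℤ} (n10 : N' 1 0 = -(16 * M ^ 2))
    (hNc : (N : ℤ) ∣ 16 * M ^ 2) : N' ∈ Gamma0 N := by
  rw [Gamma0_mem, n10, ZMod.intCast_zmod_eq_zero_iff_dvd]
  exact (dvd_neg).mpr hNc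

/-- **The branch relation.** For `X, Y` in the upper half-plane, `√(Y/X) = √Y/√X` for the principal square root (no sign: both
roots lie in the open first quadrant; the tree's `csqrt_div_mul_csqrt`). [folklore] -/
theorem csqrt_div_eq_of_im_pos {X Y : ℂ} (hX : 0 < X.im) (hY : 0 < Y.im) :
    Complex.sqrt (Y / X) = Complex.sqrt Y / Complex.sqrt X := by
  have hY0 : Y ≠ 0 := by
    intro h; rw [h] at hY; simp at hY
  have hsX : Complex.sqrt X ≠ 0 := by
    intro h0
    have : X = 0 := by rw [← csqrt_sq X, h0]; ring
    rw [this] at hX; simp at hX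
  rw [eq_div_iff hsX]
  exact csqrt_div_mul_csqrt hX hY0 hY.le

/-- `Mw′ + 64` lies in the upper half-plane for `M > 0`. [folklore] -/
theorem im_level_mul_add_pos {M : ℤ} (hM : 0 < M) (w : ℍ) (r : ℝ) : 0 < ((M : ℂ) * ((w : ℂ) + r) + 64).im := by
  have : ((M : ℂ) * ((w : ℂ) + r) + 64).im = (M : ℝ) * w.im := by simp
  rw [this]; exact mul_pos (by exact_mod_cast hM) w.im_pos

/-- **The automorphy factor of `N′` at the even translate.** In the setting of `junkConj_smul_eq` with `M ≠ 0` and `N ∣ 4Mu` (so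
`ψ(1 + 4Mu) = ψ(1)`): `χ(d′)·j(N′, z)^κ` at `z = j₁/4 + γ₀•w′` equals `√((M(w′+16)+64)/(Mw′+64))^κ` — the multiplier data are trivial
(`thetaEps_one_add_four_mul`, `shimuraSymbol_neg_sq_one_add_four_mul`). [cite: Shimura1973HalfIntegral, §1] -/
theorem autFactor_junkConj_eq {κ N : ℕ} (ψ : DirichletCharacter ℂ N) (γ₀ N' : SL(2, ℤ)) {M : ℤ} (hM : γ₀ 1 0 = M)
    (h64 : γ₀ 1 1 = 64) (hM0 : M ≠ 0) (j₁ : ℤ)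
    (n00 : N' 0 0 = 1 - 4 * M * (4 * γ₀ 0 0 + M * j₁)) (n01 : N' 0 1 = (4 * γ₀ 0 0 + M * j₁) ^ 2)
    (n10 : N' 1 0 = -(16 * M ^ 2)) (n11 : N' 1 1 = 1 + 4 * M * (4 * γ₀ 0 0 + M * j₁))
    (hNd : (N : ℤ) ∣ 4 * M * (4 * γ₀ 0 0 + M * j₁)) (w : ℍ) :
    autFactor κ N ψ N' (((j₁ : ℝ) / 4) +ᵥ (γ₀ • w)) =
      Complex.sqrt (((M : ℂ) * ((w : ℂ) + 16) + 64) / ((M : ℂ) * w + 64)) ^ κ := by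
  obtain ⟨-, hden⟩ := junkConj_smul_eq γ₀ N' hM h64 j₁ n00 n01 n10 n11 w
  have hψ : ψ ((N' 1 1 : ℤ) : ZMod N) = 1 := by
    rw [n11]
    have h1 : (((1 + 4 * M * (4 * γ₀ 0 0 + M * j₁) : ℤ)) : ZMod N) = 1 := by
      rw [Int.cast_add, Int.cast_one, (ZMod.intCast_zmod_eq_zero_iff_dvd _ N).mpr hNd, add_zero]
    rw [h1, map_one]
  have hθ : thetaFactor (N' 1 0) (N' 1 1) (((j₁ : ℝ) / 4) +ᵥ (γ₀ • w)) =
      Complex.sqrt (((M : ℂ) * ((w : ℂ) + 16) + 64) / ((M : ℂ) * w + 64)) := by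
    unfold thetaFactor
    have hcd : ((N' 1 0 : ℤ) : ℂ) * ((((j₁ : ℝ) / 4) +ᵥ (γ₀ • w) : ℍ) : ℂ) + ((N' 1 1 : ℤ) : ℂ) =
        ((M : ℂ) * ((w : ℂ) + 16) + 64) / ((M : ℂ) * w + 64) := by
      rw [← ModularGroup.denom_apply, hden, coe_vadd]; push_cast; ring
    rw [hcd, n11, n10, thetaEps_one_add_four_mul, shimuraSymbol_neg_sq_one_add_four_mul hM0]
    simp
  rw [autFactor, hψ, hθ, one_mul]

/-! ## §3 The even translates, normalised, have period `16` in `w′ = 64•w`, i.e. `1/4` in `w` -/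

/-- **P3, CORE FORM: THE NORMALISED EVEN TRANSLATE IS PERIODIC**, with ANY admissible normalisation base. Let `g ∈ M_{κ/2}(N, ψ)`
(`halfIntModularForms κ N ψ`, `4 ∣ N`), `γ₀ = [a b; M 64] ∈ SL₂(ℤ)` with `M ≠ 0`, `N ∣ 16M²`, `N ∣ 4M(4a + Mj₁)` (both automatic for
`N = 4M`, `j₁ ∈ ℤ`), and let `X, Y` in the upper half-plane have the ratio `Y/X = (M(w′+16)+64)/(Mw′+64)` (e.g. `X = Mw′ + 64`, or, in the
variable `w` with `w′ = 64•w`, P1's base `X = 8(Mw+1)`, `Y = 8(M(w+1/4)+1)`). Then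
`g(j₁/4 + γ₀•(w′+16))·(√Y^κ)⁻¹ = g(j₁/4 + γ₀•w′)·(√X^κ)⁻¹`. Mechanism: §1 (`N′`) + `apply_smul_eq_of_mem` + §2 + the branch relation.
[cite: Shimura1973HalfIntegral, §1] -/
theorem junkTranslate_periodic_of_ratio {κ N : ℕ} {ψ : DirichletCharacter ℂ N} (hN4 : 4 ∣ N) {g : ℍ → ℂ}
    (hg : g ∈ halfIntModularForms κ N ψ) (γ₀ : SL(2, ℤ)) {M : ℤ} (hM : γ₀ 1 0 = M) (h64 : γ₀ 1 1 = 64)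
    (hM0 : M ≠ 0) (hNc : (N : ℤ) ∣ 16 * M ^ 2) (j₁ : ℤ) (hNd : (N : ℤ) ∣ 4 * M * (4 * γ₀ 0 0 + M * j₁)) (w : ℍ)
    {X Y : ℂ} (hX : 0 < X.im) (hY : 0 < Y.im) (hXY : Y / X = ((M : ℂ) * ((w : ℂ) + 16) + 64) / ((M : ℂ) * w + 64)) :
    g (((j₁ : ℝ) / 4) +ᵥ (γ₀ • ((16 : ℝ) +ᵥ w))) * (Complex.sqrt Y ^ κ)⁻¹ =
      g (((j₁ : ℝ) / 4) +ᵥ (γ₀ • w)) * (Complex.sqrt X ^ κ)⁻¹ := by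
  let N' : SL(2, ℤ) := ⟨!![1 - 4 * M * (4 * γ₀ 0 0 + M * j₁), (4 * γ₀ 0 0 + M * j₁) ^ 2;
      -(16 * M ^ 2), 1 + 4 * M * (4 * γ₀ 0 0 + M * j₁)], det_junkConj_eq_one M (γ₀ 0 0) j₁⟩
  have n00 : N' 0 0 = 1 - 4 * M * (4 * γ₀ 0 0 + M * j₁) := rfl
  have n01 : N' 0 1 = (4 * γ₀ 0 0 + M * j₁) ^ 2 := rfl
  have n10 : N' 1 0 = -(16 * M ^ 2) := rfl
  have n11 : N' 1 1 = 1 + 4 * M * (4 * γ₀ 0 0 + M * j₁) := rfl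
  obtain ⟨hsmul, -⟩ := junkConj_smul_eq γ₀ N' hM h64 j₁ n00 n01 n10 n11 w
  have hmem : N' ∈ Gamma0 N := junkConj_mem_Gamma0 N' n10 hNc
  have haut := apply_smul_eq_of_mem (k := κ) (χ := ψ) hN4 hg hmem (((j₁ : ℝ) / 4) +ᵥ (γ₀ • w))
  rw [hsmul, autFactor_junkConj_eq ψ γ₀ N' hM h64 hM0 j₁ n00 n01 n10 n11 hNd w, ← hXY,
    csqrt_div_eq_of_im_pos hX hY, div_pow] at haut
  have hsX : Complex.sqrt X ^ κ ≠ 0 := by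
    refine pow_ne_zero κ fun h0 ↦ ?_
    have : X = 0 := by rw [← csqrt_sq X, h0]; ring
    rw [this] at hX; simp at hX
  have hsY : Complex.sqrt Y ^ κ ≠ 0 := by
    refine pow_ne_zero κ fun h0 ↦ ?_
    have : Y = 0 := by rw [← csqrt_sq Y, h0]; ring
    rw [this] at hY; simp at hY
  rw [haut]
  field_simp

/-- **P3 in the variable `w′` (period `16`, base `√(Mw′+64)`)**, `M > 0`: 
`g(j₁/4 + γ₀•(w′+16))·(√(M(w′+16)+64)^κ)⁻¹ = g(j₁/4 + γ₀•w′)·(√(Mw′+64)^κ)⁻¹`. [cite: Shimura1973HalfIntegral, §1] -/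
theorem junkTranslate_periodic {κ N : ℕ} {ψ : DirichletCharacter ℂ N} (hN4 : 4 ∣ N) {g : ℍ → ℂ}
    (hg : g ∈ halfIntModularForms κ N ψ) (γ₀ : SL(2, ℤ)) {M : ℤ} (hM : γ₀ 1 0 = M) (h64 : γ₀ 1 1 = 64)
    (hMpos : 0 < M) (hNc : (N : ℤ) ∣ 16 * M ^ 2) (j₁ : ℤ) (hNd : (N : ℤ) ∣ 4 * M * (4 * γ₀ 0 0 + M * j₁)) (w : ℍ) :
    g (((j₁ : ℝ) / 4) +ᵥ (γ₀ • ((16 : ℝ) +ᵥ w))) * (Complex.sqrt ((M : ℂ) * ((w : ℂ) + 16) + 64) ^ κ)⁻¹ =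
      g (((j₁ : ℝ) / 4) +ᵥ (γ₀ • w)) * (Complex.sqrt ((M : ℂ) * w + 64) ^ κ)⁻¹ := by
  have hX := im_level_mul_add_pos hMpos w 0
  simp only [ofReal_zero, add_zero] at hX
  exact junkTranslate_periodic_of_ratio hN4 hg γ₀ hM h64 hMpos.ne' hNc j₁ hNd w hX
    (by simpa using im_level_mul_add_pos hMpos w 16) rfl

/-- `c • (x + w) = c·x + c • w` for the positive-real dilation of `ℍ`: `64 • (w + 1/4) = 64•w + 16`. [folklore] -/
theorem posSMul_vadd (c : {x : ℝ // 0 < x}) (x : ℝ) (w : ℍ) : c • (x +ᵥ w) = ((c : ℝ) * x) +ᵥ (c • w) := by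
  apply UpperHalfPlane.ext
  rw [coe_pos_real_smul, coe_vadd, coe_vadd, coe_pos_real_smul, Complex.real_smul, Complex.real_smul]
  push_cast
  ring

/-- **P3 IN THE VARIABLE `w` WITH P1's BASE `√(8(Mw+1))`** (w7 g8 `apply_translate_flippedCusp`; `w′ = 64•w`, period `1/4`): for `M > 0`
and any positive-real dilation `c` with `(c : ℝ) = 64`,
`g(j₁/4 + γ₀•(c•(w + 1/4)))·(√(8(M(w+1/4)+1))^κ)⁻¹ = g(j₁/4 + γ₀•(c•w))·(√(8(Mw+1))^κ)⁻¹`. So the even part of the class cut at the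
flipped cusp, divided by P1's common base, is `(1/4)`-periodic and (§4) carries only the frequencies `4 ∣ n` of `e(nw)`.
[cite: Shimura1973HalfIntegral, §1] -/
theorem junkTranslate_periodic_quarter {κ N : ℕ} {ψ : DirichletCharacter ℂ N} (hN4 : 4 ∣ N) {g : ℍ → ℂ}
    (hg : g ∈ halfIntModularForms κ N ψ) (γ₀ : SL(2, ℤ)) {M : ℤ} (hM : γ₀ 1 0 = M) (h64 : γ₀ 1 1 = 64)
    (hMpos : 0 < M) (hNc : (N : ℤ) ∣ 16 * M ^ 2) (j₁ : ℤ) (hNd : (N : ℤ) ∣ 4 * M * (4 * γ₀ 0 0 + M * j₁))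
    (c : {x : ℝ // 0 < x}) (hc : (c : ℝ) = 64) (w : ℍ) :
    g (((j₁ : ℝ) / 4) +ᵥ (γ₀ • (c • ((1 / 4 : ℝ) +ᵥ w)))) *
        (Complex.sqrt (8 * ((M : ℂ) * ((((1 / 4 : ℝ) +ᵥ w : ℍ)) : ℂ) + 1)) ^ κ)⁻¹ =
      g (((j₁ : ℝ) / 4) +ᵥ (γ₀ • (c • w))) * (Complex.sqrt (8 * ((M : ℂ) * w + 1)) ^ κ)⁻¹ := by
  have h1 : c • ((1 / 4 : ℝ) +ᵥ w) = (16 : ℝ) +ᵥ (c • w) := by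
    rw [posSMul_vadd, hc]; norm_num
  have hcw : (((c • w : ℍ)) : ℂ) = 64 * (w : ℂ) := by
    rw [coe_pos_real_smul, hc, Complex.real_smul]; push_cast; ring
  have hMR : (0 : ℝ) < M := by exact_mod_cast hMpos
  have hX : 0 < (8 * ((M : ℂ) * w + 1)).im := by
    have : (8 * ((M : ℂ) * w + 1)).im = 8 * ((M : ℝ) * w.im) := by simp
    rw [this]; exact mul_pos (by norm_num) (mul_pos hMR w.im_pos)
  have hY : 0 < (8 * ((M : ℂ) * ((((1 / 4 : ℝ) +ᵥ w : ℍ)) : ℂ) + 1)).im := by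
    have : (8 * ((M : ℂ) * ((((1 / 4 : ℝ) +ᵥ w : ℍ)) : ℂ) + 1)).im = 8 * ((M : ℝ) * w.im) := by
      rw [coe_vadd]; simp
    rw [this]; exact mul_pos (by norm_num) (mul_pos hMR w.im_pos)
  rw [h1]
  refine junkTranslate_periodic_of_ratio hN4 hg γ₀ hM h64 hMpos.ne' hNc j₁ hNd (c • w) hX hY ?_
  have hMC : (M : ℂ) ≠ 0 := by exact_mod_cast hMpos.ne'
  have hden : (M : ℂ) * (((c • w : ℍ)) : ℂ) + 64 ≠ 0 := by
    have h := im_level_mul_add_pos hMpos (c • w) 0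
    simp only [ofReal_zero, add_zero] at h
    intro h0; rw [h0] at h; simp at h
  have hden' : (8 : ℂ) * ((M : ℂ) * w + 1) ≠ 0 := by
    intro h0; rw [h0] at hX; simp at hX
  rw [div_eq_div_iff hden' hden, hcw, coe_vadd]
  push_cast
  ring

/-! ## §4 The generic coefficient lemma: a periodic junk does not pollute the other frequencies -/

/-- `e(K/n) ≠ 1` for `n ∤ K` (`n ≥ 1`). [folklore] -/
theorem cexp_two_pi_I_mul_div_ne_one {n : ℕ} (hn : 0 < n) {K : ℕ} (hK : ¬ n ∣ K) :
    cexp (2 * π * I * ((K : ℂ) / (n : ℂ))) ≠ 1 := by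
  intro h1
  rw [Complex.exp_eq_one_iff] at h1
  obtain ⟨m, hm⟩ := h1
  have hnC : (n : ℂ) ≠ 0 := by exact_mod_cast hn.ne'
  have hπ : (2 * π * I : ℂ) ≠ 0 := by simp [Real.pi_ne_zero, Complex.I_ne_zero]
  have key : ((K : ℤ) : ℂ) = (m * n : ℤ) := by
    have e1 : 2 * π * I * ((K : ℂ) / (n : ℂ)) = (K : ℂ) / n * (2 * π * I) := by ring
    rw [e1] at hm
    have e2 := mul_right_cancel₀ hπ hm
    push_cast
    field_simp at e2
    linear_combination e2
  have key' : (K : ℤ) = m * n := by exact_mod_cast key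
  exact hK ⟨m.natAbs, by
    have := congrArg Int.natAbs key'
    simpa [Int.natAbs_mul, Int.natAbs_natCast, mul_comm] using this⟩

/-- **THE GENERIC COEFFICIENT LEMMA (periodic junk).** Let `T = MAIN + JUNK` pointwise on `ℍ`, suppose `T(w) = Σ_K g(K) 𝕢_H(w)^K` and
`MAIN(w) = Σ_K m(K) 𝕢_H(w)^K` (`HasSum`, `H > 0`), and `JUNK(P + w) = JUNK(w)` for every `w`. Then `g(K) = m(K)` at every `K` with
`e(PK/H) ≠ 1`: the junk has the expansion `Σ (g − m)(K) 𝕢_H^K`, and its `P`-periodicity forces `(g − m)(K)·(e(PK/H) − 1) = 0` by uniqueness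
of `q`-expansion coefficients (T3's `eq_zero_of_hasSum_qParam`). No holomorphy or boundedness of the junk is used. This is the
common core of T3 (D) (`P = q²`), T8 (D′) (`P = 1/q²`) and P3 (`P = 1/4`, resp. `16`). [cite: DiamondShurman2005, §1.1] -/
theorem coeff_eq_of_periodic_junk {H : ℝ} (hH : 0 < H) (P : ℝ) {T MAIN JUNK : ℍ → ℂ} (hT : ∀ w : ℍ, T w = MAIN w + JUNK w)
    {g m : ℕ → ℂ} (hg : ∀ w : ℍ, HasSum (fun K : ℕ ↦ g K * Periodic.qParam H (w : ℂ) ^ K) (T w))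
    (hm : ∀ w : ℍ, HasSum (fun K : ℕ ↦ m K * Periodic.qParam H (w : ℂ) ^ K) (MAIN w))
    (hJ : ∀ w : ℍ, JUNK (P +ᵥ w) = JUNK w) (K : ℕ) (hK : cexp (2 * π * I * P / H * K) ≠ 1) : g K = m K := by
  have hJsum : ∀ w : ℍ, HasSum (fun K : ℕ ↦ (g K - m K) * Periodic.qParam H (w : ℂ) ^ K) (JUNK w) := by
    intro w
    have h1 : JUNK w = T w - MAIN w := by rw [hT w]; ring
    rw [h1]
    refine ((hg w).sub (hm w)).congr_fun fun K ↦ ?_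
    ring
  have hzero : ∀ w : ℍ, HasSum (fun K : ℕ ↦ ((g K - m K) * (cexp (2 * π * I * P / H * K) - 1)) *
      Periodic.qParam H (w : ℂ) ^ K) 0 := by
    intro w
    have h1 := hJsum (P +ᵥ w)
    rw [hJ w] at h1
    have h2 := h1.sub (hJsum w)
    rw [sub_self] at h2
    refine h2.congr_fun fun K ↦ ?_
    rw [qParam_vadd_of_period, mul_pow, ← Complex.exp_nat_mul]
    ring
  have h := eq_zero_of_hasSum_qParam hH hzero K
  rw [mul_eq_zero, sub_eq_zero, sub_eq_zero] at h
  rcases h with h | h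
  · exact h
  · exact absurd h hK

/-- **The junk of period `1/4` in the parameter `𝕢₁(w) = e(w)`:** `g(K) = m(K)` whenever `4 ∤ K`. [cite: DiamondShurman2005, §1.1] -/
theorem coeff_eq_of_junk_period_quarter {T MAIN JUNK : ℍ → ℂ} (hT : ∀ w : ℍ, T w = MAIN w + JUNK w)
    {g m : ℕ → ℂ} (hg : ∀ w : ℍ, HasSum (fun K : ℕ ↦ g K * Periodic.qParam 1 (w : ℂ) ^ K) (T w))
    (hm : ∀ w : ℍ, HasSum (fun K : ℕ ↦ m K * Periodic.qParam 1 (w : ℂ) ^ K) (MAIN w))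
    (hJ : ∀ w : ℍ, JUNK ((1 / 4 : ℝ) +ᵥ w) = JUNK w) (K : ℕ) (hK : ¬ 4 ∣ K) : g K = m K := by
  refine coeff_eq_of_periodic_junk (by norm_num : (0 : ℝ) < 1) (1 / 4) hT hg hm hJ K ?_
  have h := cexp_two_pi_I_mul_div_ne_one (by norm_num : 0 < 4) hK
  have e : (2 * π * I * (1 / 4 : ℝ) / (1 : ℝ) * K : ℂ) = 2 * π * I * ((K : ℂ) / ((4 : ℕ) : ℂ)) := by push_cast; ring
  rwa [e]

end Summit.BirchSwinnertonDyer.BirchSwinnertonDyer.Theorems.PrintCFram.FlipRung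

end
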